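import Literature.AlgebraicGeometry.Frobenioids.ArchimedeanTheoremsInstances
import Literature.AlgebraicGeometry.Frobenioids.ArchimedeanPullbacks
import Literature.AlgebraicGeometry.Frobenioids.FiberProductsMorphisms
import Literature.AlgebraicGeometry.Frobenioids.IsometricPreSteps
import Literature.AlgebraicGeometry.Frobenioids.ArchimedeanConjRotation
import HarnessLib

/-!
# Frobenioids II, Proposition 3.5 (i) REPAIRED: lifting mono-minimal categorical quotients to
# `C = C₀ ×_{D₀} D` under Galois saturation — statements and the lift (part 1)

Mochizuki, *The geometry of Frobenioids II: poly-Frobenioids*, Kyushu J. Math. **62** (2008) 401–460,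
§3, Proposition 3.5 (i), kurims p. 34 (journal pp. 428–429) [cite: MochizukiFrdII2008, Prop 3.5 (i) p.34]:
"Let `A ∈ Ob(H)`; suppose that `B_D → A_D := Base(A)` is a mono-minimal categorical quotient of `B_D` by a
group `G_D ⊆ Aut_D(B_D)` in `D`. Then there exists a pull-back morphism `B → A` that lifts `B_D → A_D`
and a group `G ⊆ Aut_H(B)` that maps isomorphically to `G_D` such that `B → A` is a mono-minimal
categorical quotient of `B` by `G` in `H`."

As typed by abc-iut-L1-t9 (`ArchFrd.Prop35i`, instances `Prop35i_C/_A/_N/_R`), the item FAILS ON OUR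
TYPED INSTANCES (finding P35i-F1, "REFUTED-as-typed": kernel witness `ArchFrd.not_prop35i_C_collapse` over
the base `D0.collapse`, `ArchimedeanProp35iCounterexample.lean`, p413286) — this is a statement about OUR
typed sentence at OUR base categories, not a verdict on the printed item under the author's own reading of
its hypotheses (v2 of this module doc, referee finding J14-F1: the earlier wording "and as printed under its
own hypotheses — the item FAILS in general" over-claimed and is withdrawn): when `B_D` is complex over a
real `A_D` the printed sentence "it follows again from the simple, explicit structure of `H₀` … that
`B → A` is a categorical quotient of `B` by `G` in `H`" uses an element of `G_D` mapping to complex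
conjugation in `Aut_{D₀}(Spec ℂ)`, which our typed base categories need not supply. This file states the
REPAIRED item with exactly that extra
hypothesis — **Galois saturation** of the quotient datum: every automorphism of `Spec π(B_D)` over
`π(B_D → A_D)` is the image of an element of `G_D` (automatic when `A_D` is complex or `B_D` is real,
`galoisSaturated_of_isComplex`, `galoisSaturated_of_isReal_source`) — under the name `ArchFrd.Prop35iR`
(same shape as `Prop35i` with the hypothesis inserted; t9's file untouched; instance `Prop35iR_C` here, the
`A`/`N`/`R` instances to follow with their proofs), and carries out the first
half of the printed proof for `H = C`: the LIFT. Given `A ∈ Ob(C)`, `f_D : B_D → A_D` and `G_D`: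
* `liftC0` = `(Spec π B_D, A_K|_{π B_D})` ([FrdII] Def. 3.1 (iv), via `exists_pulledRegion`), the
  pull-back arrow `liftFst = (π f_D, 1, 1)` of `C₀` (`C0.isPullbackMorphism_iff`), the object
  `liftObj = (liftC0, B_D)` of `C` and the PULL-BACK MORPHISM `liftMor = (liftFst, f_D) : liftObj → A` of `C`
  lifting `f_D` (`isPullbackMorphism_liftMor`, via found's `isPullbackMorphism_fiberProduct_of_fst`);
* the splitting of "`Aut_{(H₀)_{A₀}}(B₀) → Aut_{(D₀)_{A_{D₀}}}(B_{D₀})`" (p. 34): `twistEnd σ = (σ, 1, 1)` for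
  every `σ ∈ Aut_{D₀}(Spec π B_D)` over the base arrow, the lifted automorphisms `liftAut g = ((π g, 1, 1), g)`
  and the group homomorphism `liftAutHom : G_D → Aut_C(liftObj)` (injective; its range is the group `Γ`
  "that maps isomorphically to `G_D`");
* **`isCategoricalQuotient_liftMor`**: under Galois saturation, `liftMor` IS a categorical quotient of
  `liftObj` by `Γ` in `C` ([FrdI] §0): the `D`-component of a `Γ`-invariant arrow is `G_D`-invariant and
  factors through `f_D`; its `C₀`-scalar is fixed by every element of `Aut_{D₀}` over the base arrow
  (this is where saturation enters: `D0.act_mem_scalars_of_fixed`), hence descends to a scalar of the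
  base field of `A`, which gives the `C₀`-factorisation through the pull-back arrow; uniqueness from the
  quotient in `D` and the coordinates `(Base, deg_Fr, scalar)` of `C₀`.
Mono-minimality and the closing theorem `prop35iR_C_holds : Prop35iR_C π` are in the proof-only
companion `ArchimedeanQuotientLiftingProofs.lean`. Nothing here bears on [IUTchIII] Cor. 3.12; typed ≠
proved except where a `theorem` says so.
-/

namespace Literature.AlgebraicGeometry.Frobenioids

open CategoryTheory
open scoped Pointwise

noncomputable section

universe w v v' v'' u u' u''

namespace ArchFrd

/-! ### Galois saturation and the repaired statement -/

section Statements

variable {D : Type u} [Category.{v} D] (π : D ⥤ D0)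

/-- **Galois saturation** of a quotient datum `(B_D → A_D, G_D ⊆ Aut_D(B_D))` relative to `π : D → D₀`:
every automorphism `σ` of `Spec π(B_D)` in `D₀` lying over `π(B_D → A_D)` is `π(g)` for some `g ∈ G_D`.
(Void unless `π B_D` is complex and `π A_D` real, where it asks for an element of `G_D` mapping to complex
conjugation — the hypothesis the printed proof of Prop. 3.5 (i), p. 34, uses tacitly.)
[cite: MochizukiFrdII2008, Prop 3.5 (i) p.34] -/
def GaloisSaturated {BD AD : D} (fD : BD ⟶ AD) (GD : Subgroup (Aut BD)) : Prop :=
  ∀ σ : π.obj BD ⟶ π.obj BD, σ ≫ π.map fD = π.map fD → ∃ g ∈ GD, π.map g.hom = σ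

/-- An automorphism of `Spec L` over an arrow `Spec L → Spec K` with `K` complex is the identity.
[cite: MochizukiFrdII2008, §3 p.23] -/
theorem D0.eq_id_of_comp_eq_of_isComplex {L K : D0} (b : L ⟶ K) (hK : K.IsComplex) (σ : L ⟶ L)
    (h : σ ≫ b = b) : σ = 𝟙 L := by
  cases b with
  | idReal => exact absurd hK (by decide)
  | toReal => exact absurd hK (by decide)
  | gal τ =>
    rcases D0.hom_complex_complex_eq σ with hσ | hσ
    · exact hσ
    · exfalso
      rw [hσ] at h
      change D0.Hom.gal (xor true τ) = D0.Hom.gal τ at h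
      cases τ <;> cases h

/-- `Spec ℝ` has no nontrivial endomorphism. [cite: MochizukiFrdII2008, §3 p.23] -/
theorem D0.eq_id_of_isReal {L : D0} (hL : L.IsReal) (σ : L ⟶ L) : σ = 𝟙 L := by
  unfold D0.IsReal at hL
  subst hL
  exact Subsingleton.elim _ _

/-- Galois saturation is automatic when `π(A_D)` is complex (an automorphism of `Spec ℂ` over an
isomorphism is the identity). [cite: MochizukiFrdII2008, Prop 3.5 (i) p.34] -/
theorem galoisSaturated_of_isComplex {BD AD : D} (fD : BD ⟶ AD) (GD : Subgroup (Aut BD))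
    (hA : (π.obj AD).IsComplex) : GaloisSaturated π fD GD := by
  intro σ hσ
  refine ⟨1, GD.one_mem, ?_⟩
  change π.map (𝟙 BD) = σ
  rw [π.map_id]
  exact (D0.eq_id_of_comp_eq_of_isComplex _ hA σ hσ).symm

/-- Galois saturation is automatic when `π(B_D)` is real (`Spec ℝ` has no nontrivial automorphism).
[cite: MochizukiFrdII2008, Prop 3.5 (i) p.34] -/
theorem galoisSaturated_of_isReal_source {BD AD : D} (fD : BD ⟶ AD) (GD : Subgroup (Aut BD))
    (hB : (π.obj BD).IsReal) : GaloisSaturated π fD GD := by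
  intro σ _
  refine ⟨1, GD.one_mem, ?_⟩
  change π.map (𝟙 BD) = σ
  rw [π.map_id]
  exact (D0.eq_id_of_isReal hB σ).symm

variable (G : D ⥤ ArchBase) {Φ : Dᵒᵖ ⥤ CommMonCat.{w}} {X : Type u'} [Category.{v'} X]
  (F : X ⥤ ElemFrobenioid Φ) {H : Type u''} [Category.{v''} H] (ι : H ⥤ X)

/-- **Proposition 3.5 (i), REPAIRED** (same shape as abc-iut-L1-t9's schema `ArchFrd.Prop35i`, with the
Galois-saturation hypothesis on the quotient datum inserted): for `H` with its functor `ι : H → X` to the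
Frobenioid `F : X → F_Φ` over `D`, base `G : D → D₀` of RC-iso-subanchor type and `π : D → D₀`: "Let
`A ∈ Ob(H)`; suppose that `B_D → A_D := Base(A)` is a mono-minimal categorical quotient of `B_D` by a group
`G_D ⊆ Aut_D(B_D)` in `D`" AND that `(B_D → A_D, G_D)` is Galois-saturated for `π`. "Then there exists a
pull-back morphism `B → A` that lifts `B_D → A_D` and a group `G ⊆ Aut_H(B)` that maps isomorphically to
`G_D` such that `B → A` is a mono-minimal categorical quotient of `B` by `G` in `H`."
[cite: MochizukiFrdII2008, Prop 3.5 (i) p.34] -/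
def Prop35iR : Prop :=
  RC.IsOfRCIsoSubanchorType G →
    ∀ (A : H) (BD : D) (fD : BD ⟶ PreFrobenioid.baseObj F (ι.obj A)) (GD : Subgroup (Aut BD)),
      IsMonoMinimalQuotient GD fD → GaloisSaturated π fD GD →
        ∃ (B : H) (f : B ⟶ A) (e : PreFrobenioid.baseObj F (ι.obj B) ≅ BD) (Γ : Subgroup (Aut B))
          (φ : Γ ≃* GD),
          PreFrobenioid.IsPullbackMorphism F (ι.map f) ∧
            PreFrobenioid.Base F (ι.map f) = e.hom ≫ fD ∧
            (∀ γ : Γ, PreFrobenioid.Base F (ι.map (γ : Aut B).hom) ≫ e.hom =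
              e.hom ≫ ((φ γ : GD) : Aut BD).hom) ∧
            IsMonoMinimalQuotient Γ f

/-- **Prop. 3.5 (i) REPAIRED for `H = C`** (instance shape of `ArchFrd.Prop35i_C`).
[cite: MochizukiFrdII2008, Prop 3.5 (i) p.34] -/
def Prop35iR_C : Prop := Prop35iR π (baseRC π) (C.toElem π) (𝟭 (C π))

end Statements

/-! ### A descent fact about scalars of `D₀` -/

namespace D0

/-- A scalar of `L` fixed by every automorphism of `Spec L` over `b : Spec L → Spec K` descends along
`b` to a scalar of `K` (for `L = ℂ`, `K = ℝ`: a conjugation-invariant complex number is real).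
[cite: MochizukiFrdII2008, Def 3.1 (ii) p.23] -/
theorem act_mem_scalars_of_fixed {L K : D0} (b : L ⟶ K) {u : ℂˣ} (hu : u ∈ scalars L)
    (hfix : ∀ σ : L ⟶ L, σ ≫ b = b → σ.act u = u) : b.act u ∈ scalars K := by
  cases b with
  | idReal => simpa [Hom.act, Hom.twists] using hu
  | gal τ => simp
  | toReal =>
    have h := hfix conj (Subsingleton.elim _ _)
    change galAct (Hom.twists conj) u = u at h
    rw [twists_conj, galAct_true] at h
    have h' : star (u : ℂ) = u := by rw [← Units.coe_star, h]
    change galAct (Hom.twists Hom.toReal) u ∈ scalars real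
    rw [show Hom.twists Hom.toReal = false from rfl, galAct_false, mem_scalars_real_iff]
    exact Complex.conj_eq_iff_im.mp h'

end D0

/-! ### The lift of a quotient datum to `C = C₀ ×_{D₀} D` -/

namespace QuotientLift

variable {D : Type u} [Category.{v} D] (π : D ⥤ D0) (A : C π) {BD : D} (fD : BD ⟶ A.snd)

/-- The identification `Spec K_A ≅ π(A_D)` of an object `A = (A₀, A_D, α)` of `C`, typed over the base
`K_A` of its `C₀`-component (found's `FiberProduct.e`, re-typed). [cite: MochizukiFrdI2008, Prop. 1.6] -/
def baseIso (X : C π) : X.fst.base ≅ π.obj X.snd := X.iso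

/-- The base arrow `b : Spec π(B_D) → Spec K` of `D₀` under the lift (`K` = base field of `A`).
[cite: MochizukiFrdII2008, Prop 3.5 (i) p.34] -/
def liftBase : π.obj BD ⟶ A.fst.base := π.map fD ≫ (baseIso π A).inv

/-- The angular region `A_K|_{π B_D}` of [FrdII] Def. 3.1 (iv) (chosen via `exists_pulledRegion`).
[cite: MochizukiFrdII2008, Def 3.1 (iv) p.24] -/
def liftRegion : AngularRegion ℂ :=
  (exists_pulledRegion A.fst (liftBase π A fD)).choose

/-- The defining properties of `liftRegion`. [cite: MochizukiFrdII2008, Def 3.1 (iv) p.24] -/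
theorem liftRegion_spec :
    (liftRegion π A fD).carrier = C0.pullRegion A.fst (liftBase π A fD) ∧
      (liftRegion π A fD).tip = A.fst.region.tip ∧
      (liftRegion π A fD).dir = (fun z : normOneSubgroup ℂ =>
          unitPart ℂ ((liftBase π A fD).act (z : ℂˣ))) '' A.fst.region.dir ∧
      (A.fst.region.IsIsotropic → (liftRegion π A fD).IsIsotropic) :=
  (exists_pulledRegion A.fst (liftBase π A fD)).choose_spec

/-- `A_K|_L` is the image of `A_K`. [cite: MochizukiFrdII2008, Def 3.1 (iv) p.24] -/
theorem liftRegion_carrier :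
    (liftRegion π A fD).carrier = C0.pullRegion A.fst (liftBase π A fD) :=
  (liftRegion_spec π A fD).1

/-- The object `B₀ := (Spec π(B_D), A_K|_{π B_D})` of `C₀`. [cite: MochizukiFrdII2008, Prop 3.5 (i) p.34] -/
abbrev liftC0 : C0 :=
  ⟨π.obj BD, liftRegion π A fD, fun h => by
    have f : D0.real ⟶ A.fst.base := by rw [← h]; exact liftBase π A fD
    exact (liftRegion_spec π A fD).2.2.2 (C0.isNaivelyIsotropic_of_isRealObj (D0.eq_real_of_hom_real f))⟩

/-- The pull-back arrow `(b, 1, 1) : B₀ → A₀` of `C₀` ([FrdI] Def. 1.3 (i)(c) for `C₀`).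
[cite: MochizukiFrdII2008, Prop 3.5 (i) p.34] -/
def liftFst : liftC0 π A fD ⟶ A.fst where
  base := liftBase π A fD
  degFr := 1
  scalar := 1
  scalar_mem := one_mem _
  mapsTo := by
    rw [PNat.one_coe, pow_one, one_smul]
    exact (liftRegion_carrier π A fD).le

/-- `liftFst` is a pull-back morphism of `C₀`. [cite: MochizukiFrdII2008, Ex 3.3 (ii) p.28] -/
theorem isPullbackMorphism_liftFst : PreFrobenioid.IsPullbackMorphism C0.toElem (liftFst π A fD) :=
  (C0.isPullbackMorphism_iff _).2 ⟨rfl, by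
    change (1 : ℂˣ) • (liftRegion π A fD).carrier = C0.pullRegion A.fst (liftBase π A fD)
    rw [one_smul]
    exact liftRegion_carrier π A fD⟩

/-- The object `B := (B₀, B_D)` of `C = C₀ ×_{D₀} D`. [cite: MochizukiFrdII2008, Prop 3.5 (i) p.34] -/
abbrev liftObj : C π := ⟨liftC0 π A fD, BD, Iso.refl _⟩

/-- **The pull-back morphism `B → A` that lifts `B_D → A_D`**: `((b, 1, 1), f_D)`.
[cite: MochizukiFrdII2008, Prop 3.5 (i) p.34] -/
def liftMor : liftObj π A fD ⟶ A where
  fst := liftFst π A fD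
  snd := fD
  w := by
    change (π.map fD ≫ (baseIso π A).inv) ≫ (baseIso π A).hom = 𝟙 _ ≫ π.map fD
    rw [Category.assoc, Iso.inv_hom_id, Category.comp_id, Category.id_comp]

/-- `liftMor` lifts `f_D`. [cite: MochizukiFrdII2008, Prop 3.5 (i) p.34] -/
@[simp] theorem liftMor_snd : (liftMor π A fD).snd = fD := rfl

/-- `liftMor` is a pull-back morphism of `C` ([FrdI] Prop. 1.6 (iii)).
[cite: MochizukiFrdII2008, Prop 3.5 (i) p.34] -/
theorem isPullbackMorphism_liftMor : PreFrobenioid.IsPullbackMorphism (C.toElem π) (liftMor π A fD) :=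
  PreFrobenioid.isPullbackMorphism_fiberProduct_of_fst _ (isPullbackMorphism_liftFst π A fD)

/-! ### The splitting `σ ↦ (σ, 1, 1)` and the lifted group -/

/-- The automorphism `(σ, 1, 1)` of `B₀` over `A₀` attached to `σ ∈ Aut_{D₀}(Spec L)` over the base arrow
`b` ("the natural surjection `Aut_{(H₀)_{A₀}}(B₀) → Aut_{(D₀)_{A_{D₀}}}(B_{D₀})` splits", p. 34): `A_K|_L` is
`σ`-stable since `σ ≫ b = b`. [cite: MochizukiFrdII2008, Prop 3.5 (i) p.34] -/
def twistEnd (σ : π.obj BD ⟶ π.obj BD) (hσ : σ ≫ liftBase π A fD = liftBase π A fD) :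
    liftC0 π A fD ⟶ liftC0 π A fD where
  base := σ
  degFr := 1
  scalar := 1
  scalar_mem := one_mem _
  mapsTo := by
    rw [PNat.one_coe, pow_one, one_smul]
    change (liftRegion π A fD).carrier ⊆ σ.act '' (liftRegion π A fD).carrier
    rw [liftRegion_carrier, ← C0.pullRegion_comp, hσ]

/-- `(σ, 1, 1) ≫ (τ, 1, 1) = (σ ≫ τ, 1, 1)`. [cite: MochizukiFrdII2008, Prop 3.5 (i) p.34] -/
theorem twistEnd_comp (σ τ : π.obj BD ⟶ π.obj BD) (hσ : σ ≫ liftBase π A fD = liftBase π A fD)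
    (hτ : τ ≫ liftBase π A fD = liftBase π A fD) :
    twistEnd π A fD σ hσ ≫ twistEnd π A fD τ hτ =
      twistEnd π A fD (σ ≫ τ) (by rw [Category.assoc, hτ, hσ]) := by
  refine C0.hom_ext rfl rfl ?_
  change σ.act 1 * 1 ^ ((1 : ℕ+) : ℕ) = 1
  rw [map_one, one_pow, mul_one]

/-- `(𝟙, 1, 1) = 𝟙`. [cite: MochizukiFrdII2008, Prop 3.5 (i) p.34] -/
theorem twistEnd_id : twistEnd π A fD (𝟙 _) (Category.id_comp _) = 𝟙 (liftC0 π A fD) :=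
  C0.hom_ext rfl rfl rfl

/-- `(σ, 1, 1) ≫ (b, 1, 1) = (b, 1, 1)`: the twists are automorphisms OVER `A₀`.
[cite: MochizukiFrdII2008, Prop 3.5 (i) p.34] -/
theorem twistEnd_comp_liftFst (σ : π.obj BD ⟶ π.obj BD) (hσ : σ ≫ liftBase π A fD = liftBase π A fD) :
    twistEnd π A fD σ hσ ≫ liftFst π A fD = liftFst π A fD := by
  refine C0.hom_ext hσ rfl ?_
  change σ.act 1 * 1 ^ ((1 : ℕ+) : ℕ) = 1
  rw [map_one, one_pow, mul_one]

/-- `(σ, 1, 1) ≫ (σ, 1, 1) = 𝟙` (every `σ` is an involution). [cite: MochizukiFrdII2008, Prop 3.5 (i) p.34] -/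
theorem twistEnd_comp_self (σ : π.obj BD ⟶ π.obj BD) (hσ : σ ≫ liftBase π A fD = liftBase π A fD) :
    twistEnd π A fD σ hσ ≫ twistEnd π A fD σ hσ = 𝟙 (liftC0 π A fD) := by
  refine C0.hom_ext (D0.endo_comp_self σ) rfl ?_
  change σ.act 1 * 1 ^ ((1 : ℕ+) : ℕ) = 1
  rw [map_one, one_pow, mul_one]

/-- `(σ, 1, 1)` as an automorphism of `B₀` (an involution, like `σ`).
[cite: MochizukiFrdII2008, Prop 3.5 (i) p.34] -/
def twistAut (σ : π.obj BD ⟶ π.obj BD) (hσ : σ ≫ liftBase π A fD = liftBase π A fD) :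
    liftC0 π A fD ≅ liftC0 π A fD where
  hom := twistEnd π A fD σ hσ
  inv := twistEnd π A fD σ hσ
  hom_inv_id := twistEnd_comp_self π A fD σ hσ
  inv_hom_id := twistEnd_comp_self π A fD σ hσ

/-- For `g ∈ Aut_D(B_D)` with `g ≫ f_D = f_D`, the automorphism `π(g)` lies over the base arrow.
[cite: MochizukiFrdII2008, Prop 3.5 (i) p.34] -/
theorem map_comp_liftBase (g : Aut BD) (hg : g.hom ≫ fD = fD) :
    π.map g.hom ≫ liftBase π A fD = liftBase π A fD := by
  change π.map g.hom ≫ π.map fD ≫ (baseIso π A).inv = π.map fD ≫ (baseIso π A).inv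
  rw [← Category.assoc, ← π.map_comp, hg]

/-- **The lifted automorphism `((π g, 1, 1), g)` of `B`** attached to `g ∈ Aut_D(B_D)` over `f_D`.
[cite: MochizukiFrdII2008, Prop 3.5 (i) p.34] -/
def liftAut (g : Aut BD) (hg : g.hom ≫ fD = fD) : liftObj π A fD ≅ liftObj π A fD :=
  CFP.isoMk (twistAut π A fD (π.map g.hom) (map_comp_liftBase π A fD g hg)) g
    (by change π.map g.hom ≫ 𝟙 _ = 𝟙 _ ≫ π.map g.hom; rw [Category.comp_id, Category.id_comp])

/-- Components of the lifted automorphism. [cite: MochizukiFrdII2008, Prop 3.5 (i) p.34] -/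
@[simp] theorem liftAut_hom_snd (g : Aut BD) (hg : g.hom ≫ fD = fD) : (liftAut π A fD g hg).hom.snd = g.hom :=
  rfl

/-- Components of the lifted automorphism. [cite: MochizukiFrdII2008, Prop 3.5 (i) p.34] -/
theorem liftAut_hom_fst (g : Aut BD) (hg : g.hom ≫ fD = fD) :
    (liftAut π A fD g hg).hom.fst = twistEnd π A fD (π.map g.hom) (map_comp_liftBase π A fD g hg) :=
  rfl

/-- **The group homomorphism `G_D → Aut_C(B)`** lifting a group of automorphisms of `B_D` over `f_D`.
[cite: MochizukiFrdII2008, Prop 3.5 (i) p.34] -/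
def liftAutHom (GD : Subgroup (Aut BD)) (hGD : ∀ g ∈ GD, g.hom ≫ fD = fD) :
    GD →* Aut (liftObj π A fD) where
  toFun g := liftAut π A fD g (hGD g g.2)
  map_one' := by
    apply Iso.ext
    exact CFP.hom_ext (C0.hom_ext (π.map_id BD) rfl rfl) rfl
  map_mul' g h := by
    apply Iso.ext
    refine CFP.hom_ext (C0.hom_ext (π.map_comp _ _) rfl ?_) rfl
    change (1 : ℂˣ) = (π.map (h : Aut BD).hom).act 1 * 1 ^ ((1 : ℕ+) : ℕ)
    rw [map_one, one_pow, mul_one]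

/-- The lift recovers `g` on the `D`-component; in particular it is injective.
[cite: MochizukiFrdII2008, Prop 3.5 (i) p.34] -/
theorem liftAutHom_apply_hom_snd (GD : Subgroup (Aut BD)) (hGD : ∀ g ∈ GD, g.hom ≫ fD = fD) (g : GD) :
    (liftAutHom π A fD GD hGD g).hom.snd = (g : Aut BD).hom := rfl

/-- `G_D → Aut_C(B)` is injective ("maps isomorphically to `G_D`").
[cite: MochizukiFrdII2008, Prop 3.5 (i) p.34] -/
theorem liftAutHom_injective (GD : Subgroup (Aut BD)) (hGD : ∀ g ∈ GD, g.hom ≫ fD = fD) :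
    Function.Injective (liftAutHom π A fD GD hGD) := by
  intro g h hgh
  apply Subtype.ext
  apply Iso.ext
  exact congrArg (fun k : Aut (liftObj π A fD) => k.hom.snd) hgh

/-- Every lifted automorphism fixes `liftMor` (clause (a) of a categorical quotient).
[cite: MochizukiFrdI2008, §0 p.18] -/
theorem liftAut_hom_comp_liftMor (g : Aut BD) (hg : g.hom ≫ fD = fD) :
    (liftAut π A fD g hg).hom ≫ liftMor π A fD = liftMor π A fD :=
  CFP.hom_ext (twistEnd_comp_liftFst π A fD (π.map g.hom) (map_comp_liftBase π A fD g hg)) hg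

end QuotientLift

end ArchFrd

end

end Literature.AlgebraicGeometry.Frobenioids
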